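import Mathlib
import HarnessLib
import Summits.ValiantsHypothesis.ValiantsHypothesis.Theorems.EquivariantDialLayers

/-!
# Equivariant dial, layered face — the cube-root block witness: `per_m ∉ 𝔠_m` for `m = p·q`, `p, q ≥ 3`

Support for the cell `A = EqHardBiPerm` (item `stmt-ValiantsHypothesis-23702`, draft route `SymmetryDial`) via its
layered leaf `R^lay = IdealWidthSuperpoly`.  HONEST FRAMING: `VP ≠ VNP` is NOT proved here, nor `A`, nor `R^lay`, nor
any width inequality: this file is the WITNESS HALF of the first non-evaluative («apolar») rung of the leaf — an explicit
ALGEBRA HOMOMORPHISM separating the permanent from the CHEAP IDEAL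
`𝔠_m = (t_a, s_b, x_{a,b}², (XXᵀ)_{i,k}, (XᵀX)_{j,l})` (row sums, column sums, squares, Gram entries), hence from the
ideal `(C_m)` of the cheap quadrics (`span_cheapQuadrics_le`).  Every `ℂ`-point of `V(𝔠_m)` is `X = 0` (`x² ∈ 𝔠_m`), so no
point evaluation / orbit witness can see this separation (compare the ceiling remark of `EquivariantDialLayersSquare`):
the witness is an Artinian point `Spec ℂ[z]/(z²) → V(𝔠_m)`.
MECHANISM (`blockSubst`).  Index rows and columns by `Fin p × Fin q` (`m = pq`) and send
`x_{a,b} ↦ ε_{a₂} δ_{b₁} · z_{a₁,b₂}` with weights `ε : Fin q → ℂ`, `δ : Fin p → ℂ` that are BALANCED (`∑ ε = 0`),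
SQUARE-BALANCED (`∑ ε² = 0`) and nowhere zero — roots of unity of order `≥ 3` (`exists_balanced_weights`; order `2` fails
the second condition, which is why `m = 4, 6, 8, 10` are not covered — and indeed `per_m ∈ (C_m)` for `m ≤ 8` and
`m ∈ {10, 11}` on paper).  Then `Φ(t_a) = Φ(s_b) = Φ((XXᵀ)_{ik}) = Φ((XᵀX)_{jl}) = 0` identically, `Φ(x²) ∈ (z²)`, while
the coefficient of the square-free monomial `∏_{r,c} z_{r,c}` in `Φ(per_m)` is `(∏ε)(∏δ) · #{block-Latin σ} ≠ 0` (the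
identity is block-Latin) — and members of `(z²)` have no such coefficient (`MvPolynomial.mem_ideal_span_monomial_image`).
PAPER CONSEQUENCE (NOT in this file; recorded in the lineage node): `C_m` is the full isotypic component of the quadrics of
the six cheap types `𝟙⊠𝟙, S⊠𝟙, 𝟙⊠S, S⊠S, (m-2,2)⊠𝟙, 𝟙⊠(m-2,2)` (dimension `7m² - 8m + 1`), the other quadric types have
dimension `≥ (m-1)m(m-3)/2`, so `idealWidth (biPermSubst m) per_m 2 ≥ (m-1)m(m-3)/2` for `m = pq`, `p, q ≥ 3`
(`216 > 81` at `m = 9`); the two missing kernel inputs are «`Φ` kills the cheap isotypic component» and «quadric types have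
first parts `≥ m - 2`».  CONTRAST (critic's remark): `det_m ∈ (t_1, …, t_m) ⊆ 𝔠_m` for every `m ≥ 1` (`X·𝟙 = 0` forces
`det X = 0`, and `(t)` is prime), so inside `𝔠_{pq}` the witness separates `per` from `det`; NO `det`/`VP`-side upper bound
below the `d = 2` floor is claimed anywhere.  0 named facts, 0 `def … : Prop`, 0 instances, 0 sorry; 7 small data definitions
(`rowSum`, `colSum`, `rowGram`, `colGram`, `cheapIdeal`, `cheapQuadrics`, `blockSubst`).
-/

set_option linter.dupNamespace false

namespace Summit.ValiantsHypothesis.ValiantsHypothesis.Theorems.EquivariantDialLayersBlockWitness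

open MvPolynomial Matrix Literature.Computability.AlgebraicComplexity
open Summit.ValiantsHypothesis.ValiantsHypothesis.Theorems.EquivariantDialLayers
open Equiv (Perm)

variable (n : Type*) [Fintype n]

/-! ## §1 The cheap ideal and the cheap quadrics -/

/-- Row sum `t_a = ∑_b x_{a,b}`. -/
noncomputable def rowSum (a : n) : MvPolynomial (n × n) ℂ := ∑ b, X (a, b)

/-- Column sum `s_b = ∑_a x_{a,b}`. -/
noncomputable def colSum (b : n) : MvPolynomial (n × n) ℂ := ∑ a, X (a, b)

/-- Row Gram entry `(X Xᵀ)_{i,k} = ∑_j x_{i,j} x_{k,j}`. -/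
noncomputable def rowGram (i k : n) : MvPolynomial (n × n) ℂ := ∑ j, X (i, j) * X (k, j)

/-- Column Gram entry `(Xᵀ X)_{j,l} = ∑_i x_{i,j} x_{i,l}`. -/
noncomputable def colGram (j l : n) : MvPolynomial (n × n) ℂ := ∑ i, X (i, j) * X (i, l)

/-- The CHEAP IDEAL `𝔠 = (t_a, s_b, x_{a,b}², (XXᵀ)_{i,k}, (XᵀX)_{j,l})`: row and column sums, squares of the
variables, and all Gram entries (the diagonal ones lie in the ideal of squares anyway). -/
noncomputable def cheapIdeal : Ideal (MvPolynomial (n × n) ℂ) :=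
  Ideal.span (Set.range (rowSum n) ∪ Set.range (colSum n) ∪ Set.range (fun ab : n × n => X ab ^ 2) ∪
    Set.range (fun ik : n × n => rowGram n ik.1 ik.2) ∪ Set.range (fun jl : n × n => colGram n jl.1 jl.2))

/-- The nine families of CHEAP QUADRICS `C_m` (on paper their span is the full isotypic component of the quadrics of
the types `𝟙⊠𝟙, S⊠𝟙, 𝟙⊠S, S⊠S, (m-2,2)⊠𝟙, 𝟙⊠(m-2,2)` under `𝔖_m × 𝔖_m`, of dimension `7m² - 8m + 1`). -/
noncomputable def cheapQuadrics : Set (MvPolynomial (n × n) ℂ) :=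
  Set.range (fun ab : n × n => X ab ^ 2) ∪ Set.range (fun ab : n × n => X ab * rowSum n ab.1) ∪
    Set.range (fun ab : n × n => X ab * colSum n ab.2) ∪
    Set.range (fun ab : n × n => X ab * ∑ cd : n × n, X cd) ∪
    Set.range (fun ab : n × n => rowSum n ab.1 * colSum n ab.2) ∪
    Set.range (fun ik : n × n => rowSum n ik.1 * rowSum n ik.2) ∪
    Set.range (fun jl : n × n => colSum n jl.1 * colSum n jl.2) ∪
    Set.range (fun ik : n × n => rowGram n ik.1 ik.2) ∪ Set.range (fun jl : n × n => colGram n jl.1 jl.2)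

variable {n}

/-- `t_a ∈ 𝔠`. -/
theorem rowSum_mem (a : n) : rowSum n a ∈ cheapIdeal n :=
  Ideal.subset_span (Or.inl <| Or.inl <| Or.inl <| Or.inl ⟨a, rfl⟩)

/-- `s_b ∈ 𝔠`. -/
theorem colSum_mem (b : n) : colSum n b ∈ cheapIdeal n :=
  Ideal.subset_span (Or.inl <| Or.inl <| Or.inl <| Or.inr ⟨b, rfl⟩)

/-- `x_{a,b}² ∈ 𝔠`. -/
theorem X_sq_mem (ab : n × n) : X ab ^ 2 ∈ cheapIdeal n :=
  Ideal.subset_span (Or.inl <| Or.inl <| Or.inr ⟨ab, rfl⟩)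

/-- `(XXᵀ)_{i,k} ∈ 𝔠`. -/
theorem rowGram_mem (i k : n) : rowGram n i k ∈ cheapIdeal n :=
  Ideal.subset_span (Or.inl <| Or.inr ⟨(i, k), rfl⟩)

/-- `(XᵀX)_{j,l} ∈ 𝔠`. -/
theorem colGram_mem (j l : n) : colGram n j l ∈ cheapIdeal n :=
  Ideal.subset_span (Or.inr ⟨(j, l), rfl⟩)

/-- The total sum `T = ∑ x_{c,d} = ∑_c t_c` lies in `𝔠`. -/
theorem total_mem : (∑ cd : n × n, X cd : MvPolynomial (n × n) ℂ) ∈ cheapIdeal n := by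
  rw [Fintype.sum_prod_type]
  exact Ideal.sum_mem _ fun c _ => rowSum_mem c

/-- The cheap quadrics generate an ideal inside the cheap ideal: `(C_m) ≤ 𝔠_m`. -/
theorem span_cheapQuadrics_le : Ideal.span (cheapQuadrics n) ≤ cheapIdeal n := by
  refine Ideal.span_le.2 ?_
  rintro g ((((((((⟨ab, rfl⟩ | ⟨ab, rfl⟩) | ⟨ab, rfl⟩) | ⟨ab, rfl⟩) | ⟨ab, rfl⟩) | ⟨ik, rfl⟩) | ⟨jl, rfl⟩) |
    ⟨ik, rfl⟩) | ⟨jl, rfl⟩)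
  · exact X_sq_mem ab
  · exact Ideal.mul_mem_left _ _ (rowSum_mem ab.1)
  · exact Ideal.mul_mem_left _ _ (colSum_mem ab.2)
  · exact Ideal.mul_mem_left _ _ total_mem
  · exact Ideal.mul_mem_left _ _ (colSum_mem ab.2)
  · exact Ideal.mul_mem_left _ _ (rowSum_mem ik.2)
  · exact Ideal.mul_mem_left _ _ (colSum_mem jl.2)
  · exact rowGram_mem ik.1 ik.2
  · exact colGram_mem jl.1 jl.2

/-! ## §2 The block substitution and what it kills -/

section Witness

variable {p q : ℕ} (e : n ≃ Fin p × Fin q) (ε : Fin q → ℂ) (δ : Fin p → ℂ)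

/-- The BLOCK SUBSTITUTION `x_{a,b} ↦ ε_{a₂} δ_{b₁} · z_{a₁, b₂}` (`e a = (a₁, a₂)`, `e b = (b₁, b₂)`): rows are
grouped into `p` classes of size `q` (class `a₁`, weight `ε_{a₂}`), columns into `q` classes of size `p`
(class `b₂`, weight `δ_{b₁}`), and the cell `(a,b)` goes to the block variable `z_{a₁,b₂}`. -/
noncomputable def blockSubst : MvPolynomial (n × n) ℂ →ₐ[ℂ] MvPolynomial (Fin p × Fin q) ℂ :=
  aeval fun ab : n × n => C (ε (e ab.1).2 * δ (e ab.2).1) * X ((e ab.1).1, (e ab.2).2)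

/-- The all-ones exponent `𝟙 = ∑_k e_k` (the square-free monomial `∏_k z_k`) has `𝟙_k = 1`. [textbook] -/
theorem onesExp_apply (k : Fin p × Fin q) :
    (∑ k' : Fin p × Fin q, Finsupp.single k' 1 : (Fin p × Fin q) →₀ ℕ) k = 1 := by
  simp [Finsupp.finsetSum_apply, Finsupp.single_apply]

/-- A member of the ideal of squares `(z_k²)` has no square-free top monomial `∏_k z_k`. [textbook] -/
theorem coeff_onesExp_eq_zero_of_mem_sqIdeal {f : MvPolynomial (Fin p × Fin q) ℂ}
    (hf : f ∈ Ideal.span (Set.range fun k : Fin p × Fin q => (X k : MvPolynomial (Fin p × Fin q) ℂ) ^ 2)) :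
    coeff (∑ k : Fin p × Fin q, Finsupp.single k 1) f = 0 := by
  have hset : (Set.range fun k : Fin p × Fin q => (X k ^ 2 : MvPolynomial (Fin p × Fin q) ℂ)) =
      (fun s => monomial s (1 : ℂ)) '' Set.range (fun k : Fin p × Fin q => Finsupp.single k 2) := by
    rw [← Set.range_comp]
    exact congrArg Set.range (funext fun k => X_pow_eq_monomial)
  rw [hset, mem_ideal_span_monomial_image] at hf
  by_contra h
  obtain ⟨si, ⟨k, rfl⟩, hle⟩ := hf _ (mem_support_iff.2 h)
  exact absurd (Finsupp.le_def.1 hle k) (by simp [Finsupp.single_eq_same, onesExp_apply])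

omit [Fintype n] in
/-- `Φ(x_{a,b}) = ε δ · z`. [this file] -/
theorem blockSubst_X (ab : n × n) :
    blockSubst e ε δ (X ab) = C (ε (e ab.1).2 * δ (e ab.2).1) * X ((e ab.1).1, (e ab.2).2) := by
  simp only [blockSubst, aeval_X]

/-- Balanced column weights kill the row sums: `Φ(t_a) = 0` when `∑_j δ_j = 0`. [this file] -/
theorem blockSubst_rowSum (hδ : ∑ j, δ j = 0) (a : n) : blockSubst e ε δ (rowSum n a) = 0 := by
  have h1 : blockSubst e ε δ (rowSum n a) =
      ∑ k : Fin p × Fin q, C (ε (e a).2 * δ k.1) * X ((e a).1, k.2) := by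
    simp only [rowSum, map_sum, blockSubst_X]
    exact Fintype.sum_equiv e _ _ fun b => rfl
  rw [h1, Fintype.sum_prod_type, Finset.sum_comm]
  refine Finset.sum_eq_zero fun c _ => ?_
  show ∑ r : Fin p, C (ε (e a).2 * δ r) * X ((e a).1, c) = 0
  rw [← Finset.sum_mul, ← map_sum C, ← Finset.mul_sum, hδ, mul_zero, map_zero, zero_mul]

/-- Balanced row weights kill the column sums: `Φ(s_b) = 0` when `∑_i ε_i = 0`. [this file] -/
theorem blockSubst_colSum (hε : ∑ i, ε i = 0) (b : n) : blockSubst e ε δ (colSum n b) = 0 := by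
  have h1 : blockSubst e ε δ (colSum n b) =
      ∑ k : Fin p × Fin q, C (ε k.2 * δ (e b).1) * X (k.1, (e b).2) := by
    simp only [colSum, map_sum, blockSubst_X]
    exact Fintype.sum_equiv e _ _ fun a => rfl
  rw [h1, Fintype.sum_prod_type]
  refine Finset.sum_eq_zero fun r _ => ?_
  show ∑ c : Fin q, C (ε c * δ (e b).1) * X (r, (e b).2) = 0
  rw [← Finset.sum_mul, ← map_sum C, ← Finset.sum_mul, hε, zero_mul, map_zero, zero_mul]

/-- Square-balanced column weights kill the row Gram entries: `Φ((XXᵀ)_{i,k}) = 0` when `∑_j δ_j² = 0`.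
[this file] -/
theorem blockSubst_rowGram (hδ2 : ∑ j, δ j ^ 2 = 0) (i k : n) : blockSubst e ε δ (rowGram n i k) = 0 := by
  have h1 : blockSubst e ε δ (rowGram n i k) = ∑ c : Fin p × Fin q,
      C (ε (e i).2 * ε (e k).2 * δ c.1 ^ 2) * (X ((e i).1, c.2) * X ((e k).1, c.2)) := by
    simp only [rowGram, map_sum, map_mul, blockSubst_X]
    refine Fintype.sum_equiv e _ _ fun j => ?_
    simp only [map_pow]
    ring
  rw [h1, Fintype.sum_prod_type, Finset.sum_comm]
  refine Finset.sum_eq_zero fun c _ => ?_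
  show ∑ r : Fin p, C (ε (e i).2 * ε (e k).2 * δ r ^ 2) * (X ((e i).1, c) * X ((e k).1, c)) = 0
  rw [← Finset.sum_mul, ← map_sum C, ← Finset.mul_sum, hδ2, mul_zero, map_zero, zero_mul]

/-- Square-balanced row weights kill the column Gram entries: `Φ((XᵀX)_{j,l}) = 0` when `∑_i ε_i² = 0`.
[this file] -/
theorem blockSubst_colGram (hε2 : ∑ i, ε i ^ 2 = 0) (j l : n) : blockSubst e ε δ (colGram n j l) = 0 := by
  have h1 : blockSubst e ε δ (colGram n j l) = ∑ r : Fin p × Fin q,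
      C (ε r.2 ^ 2 * (δ (e j).1 * δ (e l).1)) * (X (r.1, (e j).2) * X (r.1, (e l).2)) := by
    simp only [colGram, map_sum, map_mul, blockSubst_X]
    refine Fintype.sum_equiv e _ _ fun i => ?_
    simp only [map_pow]
    ring
  rw [h1, Fintype.sum_prod_type]
  refine Finset.sum_eq_zero fun r _ => ?_
  show ∑ c : Fin q, C (ε c ^ 2 * (δ (e j).1 * δ (e l).1)) * (X (r, (e j).2) * X (r, (e l).2)) = 0
  rw [← Finset.sum_mul, ← map_sum C, ← Finset.sum_mul, hε2, zero_mul, map_zero, zero_mul]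

omit [Fintype n] in
/-- Squares go to the ideal of squares. [this file] -/
theorem blockSubst_X_sq (ab : n × n) : blockSubst e ε δ (X ab ^ 2) ∈
    Ideal.span (Set.range fun k : Fin p × Fin q => (X k : MvPolynomial (Fin p × Fin q) ℂ) ^ 2) := by
  rw [map_pow, blockSubst_X, mul_pow]
  exact Ideal.mul_mem_left _ _ (Ideal.subset_span ⟨_, rfl⟩)

/-- Hence the whole cheap ideal is mapped into the ideal of squares. [this file] -/
theorem map_cheapIdeal_le (hε : ∑ i, ε i = 0) (hε2 : ∑ i, ε i ^ 2 = 0) (hδ : ∑ j, δ j = 0)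
    (hδ2 : ∑ j, δ j ^ 2 = 0) : Ideal.map (blockSubst e ε δ) (cheapIdeal n) ≤
      Ideal.span (Set.range fun k : Fin p × Fin q => (X k : MvPolynomial (Fin p × Fin q) ℂ) ^ 2) := by
  rw [cheapIdeal, Ideal.map_span]
  refine Ideal.span_le.2 ?_
  rintro g ⟨f, ((((⟨a, rfl⟩ | ⟨b, rfl⟩) | ⟨ab, rfl⟩) | ⟨ik, rfl⟩) | ⟨jl, rfl⟩), rfl⟩
  · rw [SetLike.mem_coe, blockSubst_rowSum e ε δ hδ]; exact zero_mem _
  · rw [SetLike.mem_coe, blockSubst_colSum e ε δ hε]; exact zero_mem _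
  · exact blockSubst_X_sq e ε δ ab
  · rw [SetLike.mem_coe]; exact (blockSubst_rowGram e ε δ hδ2 ik.1 ik.2).symm ▸ zero_mem _
  · rw [SetLike.mem_coe]; exact (blockSubst_colGram e ε δ hε2 jl.1 jl.2).symm ▸ zero_mem _

/-! ## §3 What the block substitution sees: the square-free top coefficient of `Φ(per)` -/

/-- A product of variables is the monomial of the sum of their exponents. [textbook] -/
theorem prod_X_eq_monomial {ι σ : Type*} (s : Finset ι) (k : ι → σ) :
    ∏ i ∈ s, (X (k i) : MvPolynomial σ ℂ) = monomial (∑ i ∈ s, Finsupp.single (k i) 1) 1 := by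
  classical
  refine Finset.induction_on s ?_ (@fun a s ha ih => ?_)
  · rw [Finset.prod_empty, Finset.sum_empty, ← C_apply, C_1]
  · rw [Finset.prod_insert ha, Finset.sum_insert ha, ih, ← pow_one (X (k a)), X_pow_eq_monomial,
      monomial_mul, one_mul]

/-- The exponent of the identity permutation's block monomial is the all-ones vector. [this file] -/
theorem sum_single_eq_onesExp :
    ∑ i : n, Finsupp.single (((e i).1, (e i).2) : Fin p × Fin q) 1 = ∑ k : Fin p × Fin q, Finsupp.single k 1 := by
  simp only [Prod.mk.eta]
  exact e.sum_comp (fun k : Fin p × Fin q => Finsupp.single k 1)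

/-- The square-free top coefficient of `Φ(per)` is `(∏_a ε)(∏_b δ) · #{block-Latin permutations} ≠ 0`
(the weight does not depend on the permutation, and the identity permutation is block-Latin). [this file] -/
theorem coeff_onesExp_blockSubst_perPoly_ne_zero [DecidableEq n] (hε0 : ∀ i, ε i ≠ 0) (hδ0 : ∀ j, δ j ≠ 0) :
    coeff (∑ k : Fin p × Fin q, Finsupp.single k 1) (blockSubst e ε δ (perPoly n ℂ)) ≠ 0 := by
  classical
  have hW : (∏ i : n, ε (e i).2) * ∏ i : n, δ (e i).1 ≠ 0 :=
    mul_ne_zero (Finset.prod_ne_zero_iff.2 fun i _ => hε0 _) (Finset.prod_ne_zero_iff.2 fun i _ => hδ0 _)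
  -- closed form of `Φ(per)`: a constant weight times a sum of block monomials
  have hΦ : blockSubst e ε δ (perPoly n ℂ) = ∑ σ : Perm n, C ((∏ i : n, ε (e i).2) * ∏ i : n, δ (e i).1) *
      monomial (∑ i : n, Finsupp.single (((e (σ i)).1, (e i).2) : Fin p × Fin q) 1) 1 := by
    simp only [perPoly, Matrix.permanent, Matrix.mvPolynomialX_apply, map_sum, map_prod, blockSubst_X]
    refine Finset.sum_congr rfl fun σ _ => ?_
    have hσ : ∏ i : n, ε (e (σ i)).2 = ∏ i : n, ε (e i).2 := Fintype.prod_equiv σ _ _ fun i => rfl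
    rw [Finset.prod_mul_distrib, ← map_prod C, prod_X_eq_monomial, Finset.prod_mul_distrib, hσ]
  -- its coefficient at the all-ones exponent
  have hcoeff : coeff (∑ k : Fin p × Fin q, Finsupp.single k 1) (blockSubst e ε δ (perPoly n ℂ)) =
      ∑ σ : Perm n, if (∑ i : n, Finsupp.single (((e (σ i)).1, (e i).2) : Fin p × Fin q) 1) =
        ∑ k : Fin p × Fin q, Finsupp.single k 1 then (∏ i : n, ε (e i).2) * ∏ i : n, δ (e i).1 else 0 := by
    rw [hΦ, coeff_sum]
    refine Finset.sum_congr rfl fun σ _ => ?_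
    rw [coeff_C_mul, coeff_monomial]
    split_ifs <;> simp
  rw [hcoeff, Finset.sum_ite, Finset.sum_const_zero, add_zero, Finset.sum_const, nsmul_eq_mul]
  refine mul_ne_zero (Nat.cast_ne_zero.2 (Finset.card_ne_zero.2 ⟨1, ?_⟩)) hW
  simp only [Finset.mem_filter, Finset.mem_univ, true_and, Equiv.Perm.coe_one, id_eq]
  exact sum_single_eq_onesExp e

include e in
/-- **Abstract block witness.**  Balanced, square-balanced, nowhere-zero weights separate `per` from `𝔠`.
[this file] -/
theorem perPoly_not_mem_cheapIdeal_of_weights [DecidableEq n] (hε : ∑ i, ε i = 0) (hε2 : ∑ i, ε i ^ 2 = 0)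
    (hε0 : ∀ i, ε i ≠ 0) (hδ : ∑ j, δ j = 0) (hδ2 : ∑ j, δ j ^ 2 = 0) (hδ0 : ∀ j, δ j ≠ 0) :
    perPoly n ℂ ∉ cheapIdeal n := fun h =>
  coeff_onesExp_blockSubst_perPoly_ne_zero e ε δ hε0 hδ0 (coeff_onesExp_eq_zero_of_mem_sqIdeal
    (map_cheapIdeal_le e ε δ hε hε2 hδ hδ2 (Ideal.mem_map_of_mem _ h)))

end Witness

/-! ## §4 Roots of unity; the theorems -/

/-- A primitive root of unity of order `q ≥ 3` gives balanced, square-balanced, nowhere-zero weights. [textbook] -/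
theorem balanced_of_isPrimitiveRoot {q : ℕ} (hq : 3 ≤ q) {ζ : ℂ} (hζ : IsPrimitiveRoot ζ q) :
    ∑ i : Fin q, ζ ^ (i : ℕ) = 0 ∧ ∑ i : Fin q, (ζ ^ (i : ℕ)) ^ 2 = 0 ∧ ∀ i : Fin q, ζ ^ (i : ℕ) ≠ 0 := by
  refine ⟨?_, ?_, fun i => pow_ne_zero _ (hζ.ne_zero (by omega))⟩
  · have h := hζ.geom_sum_eq_zero (by omega : 1 < q)
    rw [← Fin.sum_univ_eq_sum_range] at h
    exact h
  · have h2 : ζ ^ 2 ≠ 1 := by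
      rw [Ne, hζ.pow_eq_one_iff_dvd]
      intro hd
      have := Nat.le_of_dvd two_pos hd
      omega
    have hq2 : (ζ ^ 2) ^ q = 1 := by rw [← pow_mul, mul_comm, pow_mul, hζ.pow_eq_one, one_pow]
    have hgeom := mul_geom_sum (ζ ^ 2) q
    rw [hq2, sub_self, mul_eq_zero] at hgeom
    have hsum : ∑ i ∈ Finset.range q, (ζ ^ 2) ^ i = 0 := hgeom.resolve_left (sub_ne_zero.2 h2)
    have hpow : ∀ i : ℕ, (ζ ^ i) ^ 2 = (ζ ^ 2) ^ i := fun i => by rw [← pow_mul, ← pow_mul, mul_comm]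
    simp_rw [hpow]
    rw [← Fin.sum_univ_eq_sum_range] at hsum
    exact hsum

/-- Roots of unity of order `q ≥ 3` are balanced, square-balanced and nowhere zero. [textbook] -/
theorem exists_balanced_weights {q : ℕ} (hq : 3 ≤ q) :
    ∃ ε : Fin q → ℂ, ∑ i, ε i = 0 ∧ ∑ i, ε i ^ 2 = 0 ∧ ∀ i, ε i ≠ 0 :=
  ⟨fun i => Complex.exp (2 * Real.pi * Complex.I / q) ^ (i : ℕ),
    balanced_of_isPrimitiveRoot hq (Complex.isPrimitiveRoot_exp q (by omega))⟩

/-- **The cube-root block witness.**  If the index set is a `p × q` box with `p, q ≥ 3`, the generic permanent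
does not lie in the cheap ideal `𝔠 = (t_a, s_b, x_{a,b}², (XXᵀ)_{i,k}, (XᵀX)_{j,l})`. [this file] -/
theorem perPoly_not_mem_cheapIdeal [DecidableEq n] {p q : ℕ} (e : n ≃ Fin p × Fin q) (hp : 3 ≤ p) (hq : 3 ≤ q) :
    perPoly n ℂ ∉ cheapIdeal n := by
  obtain ⟨ε, hε, hε2, hε0⟩ := exists_balanced_weights hq
  obtain ⟨δ, hδ, hδ2, hδ0⟩ := exists_balanced_weights hp
  exact perPoly_not_mem_cheapIdeal_of_weights e ε δ hε hε2 hε0 hδ hδ2 hδ0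

/-- In particular `per_m ∉ (C_m)`: no ideal generated inside the cheap quadrics contains the permanent.
[this file] -/
theorem perPoly_not_mem_span_cheapQuadrics [DecidableEq n] {p q : ℕ} (e : n ≃ Fin p × Fin q) (hp : 3 ≤ p)
    (hq : 3 ≤ q) :
    perPoly n ℂ ∉ Ideal.span (cheapQuadrics n) := fun h =>
  perPoly_not_mem_cheapIdeal e hp hq (span_cheapQuadrics_le h)

/-- `m = p·q`: the permanent `per_{pq}` in the variables `Fin (p*q) × Fin (p*q)` escapes `𝔠_{pq}`. [this file] -/
theorem perPoly_fin_mul_not_mem_cheapIdeal {p q : ℕ} (hp : 3 ≤ p) (hq : 3 ≤ q) :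
    perPoly (Fin (p * q)) ℂ ∉ cheapIdeal (Fin (p * q)) :=
  perPoly_not_mem_cheapIdeal finProdFinEquiv.symm hp hq

/-- The first instance: `per_9 ∉ 𝔠_9` (the core `K_{3,3}`). [this file] -/
theorem perPoly_fin9_not_mem_cheapIdeal : perPoly (Fin 9) ℂ ∉ cheapIdeal (Fin 9) :=
  perPoly_fin_mul_not_mem_cheapIdeal (p := 3) (q := 3) le_rfl le_rfl

/-- Cell-`A` reading: every degree-`d` cut system for `per` on a `p × q` box (`p, q ≥ 3`) — in particular every
system realising `idealWidth (biPermSubst (p*q)) per_{pq} d` — contains a form OUTSIDE the cheap ideal `𝔠`.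
[this file] -/
theorem exists_not_mem_cheapIdeal_of_hasIdealWidthLE [DecidableEq n] {p q : ℕ} (e : n ≃ Fin p × Fin q)
    (hp : 3 ≤ p) (hq : 3 ≤ q) {Γ : Subgroup (GL (n × n) ℂ)} {d r : ℕ} (h : HasIdealWidthLE Γ (perPoly n ℂ) d r) :
    ∃ s : Finset (MvPolynomial (n × n) ℂ), s.card ≤ r ∧ perPoly n ℂ ∈ Ideal.span (s : Set _) ∧
      ∃ f ∈ s, f ∉ cheapIdeal n := by
  obtain ⟨s, hs, -, -, hf⟩ := h
  refine ⟨s, hs, hf, ?_⟩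
  by_contra hall
  push Not at hall
  exact perPoly_not_mem_cheapIdeal e hp hq ((Ideal.span_le.2 fun f hfs => hall f hfs) hf)

end Summit.ValiantsHypothesis.ValiantsHypothesis.Theorems.EquivariantDialLayersBlockWitness
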